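import Mathlib
import HarnessLib
import Summits.ValiantsHypothesis.ValiantsHypothesis.Theorems.MonotoneRestorationOrbitRestorationLinearVolumeQPPerExcluded

/-!
# The row-shadow criterion for homomorphism expansions, and the Hamiltonian cycle polynomial (stmt-18294 calibration)

Route MonotoneRestoration, item `OrbitRestorationLinearVolumeQP` (R1, stmt-ValiantsHypothesis-18294).  Sequel to
`Theorems/MonotoneRestorationOrbitRestorationLinearVolumeQPPerExcluded.lean` (`perPoly_not_polyDimension_homExpansion`):
that proof uses about the permanent only that its ROW SHADOW `per_n(x_ij ↦ u_i)` is a nonzero multiple of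
`u_1 ⋯ u_n = e_n(u)`.  Here the criterion is recorded in that generality and applied to the Hamiltonian cycle polynomial:

* `not_polyDimension_homExpansion_of_rowShadow` — a family whose row shadow is, for all large `n`, a NONZERO scalar
  multiple of `u_1 ⋯ u_n` has no polynomial-dimension homomorphism expansion (`m_n ≤ (n+2)^c` patterns);
* `rowShadow_hcPoly` — `HC_n(x_ij ↦ u_i) = #{n-cycles} · u_1 ⋯ u_n`; `hcPoly_not_polyDimension_homExpansion` — so R1's
  hypothesis class excludes `HC_n` (tree `hcPoly`) as well as `per_n`.

Honest framing: calibration lemmas for an OPEN aside item; nothing here is progress on `VP ≠ VNP`.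
[cite: DwivediPagoSeppelt2026, §1 eq. (1) and Outlook (p. 12)]
-/

noncomputable section

open MvPolynomial Finset

-- `Summit.ValiantsHypothesis.ValiantsHypothesis.…` is the tree's single-conjunct layout (Sub = Summit).
set_option linter.dupNamespace false

namespace Summit.ValiantsHypothesis.ValiantsHypothesis.Theorems

namespace PerHomExpansion

open Literature.Computability.AlgebraicComplexity
open Literature.RepresentationTheory.ClassicalInvariants


/-- Growth, with a lower bound on `t`: for every `c, T` some `t ≥ T` has `(Σ_{j<t} (j+2) + 2)^c < 2^t`. [folklore] -/
theorem exists_two_pow_gt_ge (c T : ℕ) : ∃ t : ℕ, T ≤ t ∧ ((∑ j : Fin t, ((j : ℕ) + 2)) + 2) ^ c < 2 ^ t := by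
  have hlim : Filter.Tendsto (fun k : ℕ => (k : ℝ) ^ (2 * c) / (2 : ℝ) ^ k) Filter.atTop (nhds 0) :=
    tendsto_pow_const_div_const_pow_of_one_lt (2 * c) one_lt_two
  have hsmall : (0 : ℝ) < 1 / 4 ^ c := by positivity
  obtain ⟨T', hT'⟩ := Filter.eventually_atTop.1 (hlim.eventually (gt_mem_nhds hsmall))
  refine ⟨max (max T' 2) T, le_max_right _ _, ?_⟩
  set t := max (max T' 2) T with htdef
  have ht2 : 2 ≤ t := (le_max_right _ _).trans (le_max_left _ _)
  have hsum : (∑ j : Fin t, ((j : ℕ) + 2)) + 2 ≤ (t + 2) ^ 2 := by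
    have : ∑ j : Fin t, ((j : ℕ) + 2) ≤ ∑ _j : Fin t, (t + 1) :=
      Finset.sum_le_sum fun j _ => by have := j.2; omega
    rw [Finset.sum_const, Finset.card_univ, Fintype.card_fin, smul_eq_mul] at this
    nlinarith
  have hreal : ((t : ℝ) + 2) ^ (2 * c) < (2 : ℝ) ^ t := by
    have h1 := hT' t ((le_max_left _ _).trans (le_max_left _ _))
    have h2t : (0 : ℝ) < (2 : ℝ) ^ t := by positivity
    have h4c : (0 : ℝ) < (4 : ℝ) ^ c := by positivity
    rw [div_lt_iff₀ h2t] at h1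
    have h3 : ((t : ℝ) + 2) ^ (2 * c) ≤ (4 : ℝ) ^ c * (t : ℝ) ^ (2 * c) := by
      have : (t : ℝ) + 2 ≤ 2 * t := by
        have : (2 : ℝ) ≤ t := by exact_mod_cast ht2
        linarith
      calc ((t : ℝ) + 2) ^ (2 * c) ≤ (2 * (t : ℝ)) ^ (2 * c) := pow_le_pow_left₀ (by positivity) this _
        _ = (4 : ℝ) ^ c * (t : ℝ) ^ (2 * c) := by rw [mul_pow, pow_mul]; norm_num
    have h4 : (4 : ℝ) ^ c * (t : ℝ) ^ (2 * c) < (4 : ℝ) ^ c * (1 / 4 ^ c * (2 : ℝ) ^ t) :=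
      mul_lt_mul_of_pos_left h1 h4c
    have h5 : (4 : ℝ) ^ c * (1 / 4 ^ c * (2 : ℝ) ^ t) = (2 : ℝ) ^ t := by
      field_simp
    linarith
  have hnat : ((∑ j : Fin t, ((j : ℕ) + 2)) + 2) ^ c ≤ (t + 2) ^ (2 * c) := by
    rw [pow_mul]
    exact Nat.pow_le_pow_left hsum c
  have : ((t + 2) ^ (2 * c) : ℕ) < 2 ^ t := by exact_mod_cast hreal
  omega

/-- **The row-shadow criterion**: a family whose row shadow `f_n(x_ij ↦ u_i)` is, for all large `n`, a NONZERO scalar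
multiple of `u_1 ⋯ u_n` has no polynomial-dimension homomorphism expansion. [cite: DwivediPagoSeppelt2026, Outlook (p. 12)] -/
theorem not_polyDimension_homExpansion_of_rowShadow (f : (n : ℕ) → MvPolynomial (Fin n × Fin n) ℂ)
    (hf : ∃ n₀ : ℕ, ∀ n : ℕ, n₀ ≤ n → ∃ r : ℂ, r ≠ 0 ∧
      aeval (fun p : Fin n × Fin n => (X p.1 : MvPolynomial (Fin n) ℂ)) (f n) =
        MvPolynomial.C r * ∏ i : Fin n, X i) :
    ¬ ∃ (c : ℕ) (m : ℕ → ℕ) (a b : (n : ℕ) → Fin (m n) → ℕ)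
        (E : (n : ℕ) → (i : Fin (m n)) → Multiset (Fin (a n i) × Fin (b n i))) (α : (n : ℕ) → Fin (m n) → ℂ),
        (∀ n, m n ≤ (n + 2) ^ c) ∧
          ∀ n, f n = ∑ i : Fin (m n), MvPolynomial.C (α n i) * homPoly (E n i) n ℂ := by
  classical
  obtain ⟨n₀, hf⟩ := hf
  rintro ⟨c, m, a, b, E, α, hm, hrep⟩
  obtain ⟨t, hTt, ht⟩ := exists_two_pow_gt_ge c n₀
  -- the level `n = Σ_{j<t} (j+2) ≥ t ≥ n₀`
  set n : ℕ := ∑ j : Fin t, ((j : ℕ) + 2) with hndef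
  have hn₀ : n₀ ≤ n := by
    have : ∑ _j : Fin t, 1 ≤ ∑ j : Fin t, ((j : ℕ) + 2) := Finset.sum_le_sum fun j _ => by omega
    rw [Finset.sum_const, Finset.card_univ, Fintype.card_fin, smul_eq_mul, mul_one] at this
    omega
  obtain ⟨r, hr, hshadow⟩ := hf n hn₀
  let ps : Fin n → MvPolynomial (Fin n) ℂ := fun j => psum (Fin n) ℂ ((j : ℕ) + 1)
  have hinj : Function.Injective (aeval ps) :=
    algebraicIndependent_iff_injective_aeval.1 (PowerSumBasicInvariants.algebraicIndependent_psum n)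
  let deg : (i : Fin (m n)) → Fin (a n i) → ℕ := fun i v => ((E n i).map Prod.fst).count v
  have hdegsum : ∀ i, ∑ v, deg i v = Multiset.card (E n i) := by
    intro i
    simp only [deg]
    rw [Multiset.sum_count_eq_card (fun _ _ => Finset.mem_univ _), Multiset.card_map]
  have hdegle : ∀ i, Multiset.card (E n i) = n → ∀ v, deg i v ≤ n := by
    intro i hi v
    rw [← hi, ← hdegsum i]
    exact Finset.single_le_sum (f := deg i) (fun _ _ => Nat.zero_le _) (Finset.mem_univ v)
  -- Step 1: the row shadow of the representation
  have h1 : MvPolynomial.C r * ∏ i : Fin n, X i =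
      ∑ i : Fin (m n), MvPolynomial.C (α n i) *
        (((n ^ Fintype.card (Fin (b n i)) : ℕ) : MvPolynomial (Fin n) ℂ) * ∏ v, psum (Fin n) ℂ (deg i v)) := by
    have h := congrArg (aeval fun p : Fin n × Fin n => (X p.1 : MvPolynomial (Fin n) ℂ)) (hrep n)
    rw [hshadow, map_sum] at h
    rw [h]
    refine Finset.sum_congr rfl fun i _ => ?_
    rw [map_mul, aeval_C, algebraMap_eq, rowShadow_homPoly]
  -- Step 2: the degree-`n` component
  have hLhom : (MvPolynomial.C r * ∏ i : Fin n, X i).IsHomogeneous n := by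
    have hp : (∏ i : Fin n, (X i : MvPolynomial (Fin n) ℂ)).IsHomogeneous n := by
      have := IsHomogeneous.prod Finset.univ (fun i : Fin n => (X i : MvPolynomial (Fin n) ℂ)) (fun _ => 1)
        fun i _ => isHomogeneous_X ℂ i
      simpa using this
    simpa using (isHomogeneous_C _ r).mul hp
  have hcomp : ∀ i : Fin (m n), homogeneousComponent n (MvPolynomial.C (α n i) *
      (((n ^ Fintype.card (Fin (b n i)) : ℕ) : MvPolynomial (Fin n) ℂ) * ∏ v, psum (Fin n) ℂ (deg i v))) =
      if n = Multiset.card (E n i) then MvPolynomial.C (α n i) *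
        (((n ^ Fintype.card (Fin (b n i)) : ℕ) : MvPolynomial (Fin n) ℂ) * ∏ v, psum (Fin n) ℂ (deg i v)) else 0 := by
    intro i
    rw [← map_natCast (MvPolynomial.C : ℂ →+* MvPolynomial (Fin n) ℂ), ← mul_assoc, ← map_mul,
      homogeneousComponent_C_mul, homogeneousComponent_of_mem (isHomogeneous_prod_psum n (deg i)), hdegsum i]
    split_ifs <;> simp
  have h2 : MvPolynomial.C r * ∏ i : Fin n, X i =
      ∑ i : Fin (m n), if n = Multiset.card (E n i) then MvPolynomial.C (α n i) *
        (((n ^ Fintype.card (Fin (b n i)) : ℕ) : MvPolynomial (Fin n) ℂ) * ∏ v, psum (Fin n) ℂ (deg i v)) else 0 := by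
    have h := congrArg (homogeneousComponent n) h1
    rw [homogeneousComponent_eq_self hLhom, map_sum] at h
    rw [h]
    exact Finset.sum_congr rfl fun i _ => hcomp i
  -- Step 3: every surviving term is a scalar times the image of ONE monomial of weight `n`
  have hterm : ∀ i : Fin (m n), ∃ (mv : Fin n →₀ ℕ) (γ : ℂ),
      (n = Multiset.card (E n i) → (∑ j : Fin n, mv j * ((j : ℕ) + 1)) = n) ∧
      (if n = Multiset.card (E n i) then MvPolynomial.C (α n i) *
        (((n ^ Fintype.card (Fin (b n i)) : ℕ) : MvPolynomial (Fin n) ℂ) * ∏ v, psum (Fin n) ℂ (deg i v)) else 0) =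
        aeval ps (monomial mv γ) := by
    intro i
    by_cases hi : n = Multiset.card (E n i)
    · obtain ⟨mv, hw, hprod⟩ := exists_expVec (K := ℂ) n (deg i) (hdegle i hi.symm)
      refine ⟨mv, α n i * ((n ^ Fintype.card (Fin (b n i)) : ℕ) : ℂ) *
        ((n ^ (Finset.univ.filter fun v => deg i v = 0).card : ℕ) : ℂ), fun _ => by rw [hw, hdegsum]; exact hi.symm, ?_⟩
      rw [if_pos hi, hprod, ← mul_one (α n i * _ * _), ← C_mul_monomial, map_mul, aeval_C, algebraMap_eq]
      simp only [map_mul, map_natCast]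
      ring
    · exact ⟨0, 0, fun h => absurd h hi, by rw [if_neg hi, monomial_zero', map_zero, map_zero]⟩
  choose mv γ hmvw hmveq using hterm
  -- Step 4: read the identity in `ℂ[y]` through the injective substitution `y_j ↦ p_{j+1}`
  have hex := Literature.RingTheory.MvPolynomial.BlockSymmetric.esymm_mem_adjoin_psum (K := ℂ) (n := n)
    (k := n) le_rfl
  rw [Algebra.adjoin_range_eq_range_aeval] at hex
  obtain ⟨Q₀, hQ₀⟩ := hex
  have hQ₀' : aeval ps Q₀ = esymm (Fin n) ℂ n := hQ₀
  have hident : MvPolynomial.C r * Q₀ = ∑ i : Fin (m n), monomial (mv i) (γ i) := by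
    apply hinj
    rw [map_mul, aeval_C, algebraMap_eq, hQ₀', ← prod_X_eq_esymm, h2, map_sum]
    exact Finset.sum_congr rfl fun i _ => hmveq i
  -- Step 5: every weight-`n` exponent vector is one of the `mv i`
  have hall : ∀ w : Fin n →₀ ℕ, (∑ j : Fin n, w j * ((j : ℕ) + 1)) = n →
      w ∈ Finset.univ.image mv := by
    intro w hw
    have hne : coeff w Q₀ ≠ 0 :=
      ElementaryPowerSumSupport.coeff_ne_zero_of_aeval_psum_eq_esymm n n le_rfl Q₀ hQ₀' w hw
    have hne' : coeff w (∑ i : Fin (m n), monomial (mv i) (γ i)) ≠ 0 := by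
      rw [← hident, coeff_C_mul]
      exact mul_ne_zero hr hne
    rw [coeff_sum] at hne'
    obtain ⟨i, -, hi⟩ := Finset.exists_ne_zero_of_sum_ne_zero hne'
    rw [coeff_monomial] at hi
    have hwi : mv i = w := by
      by_contra h
      exact hi (if_neg h)
    exact Finset.mem_image.2 ⟨i, Finset.mem_univ _, hwi⟩
  -- Step 6: count
  have hcount : 2 ^ t ≤ (Finset.univ.image mv).card := card_weightVectors_ge n t le_rfl _ hall
  have hle : (Finset.univ.image mv).card ≤ m n :=
    Finset.card_image_le.trans (by rw [Finset.card_univ, Fintype.card_fin])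
  have := hm n
  omega

/-- **Row shadow of the Hamiltonian cycle polynomial**: `HC_n(x_ij ↦ u_i) = #{n-cycles in 𝔖_n} · u_1 ⋯ u_n`. [folklore] -/
theorem rowShadow_hcPoly (n : ℕ) :
    aeval (fun p : Fin n × Fin n => (X p.1 : MvPolynomial (Fin n) ℂ)) (hcPoly (Fin n) ℂ) =
      MvPolynomial.C (((Finset.univ.filter fun π : Equiv.Perm (Fin n) =>
        π.cycleType = {Fintype.card (Fin n)}).card : ℕ) : ℂ) * ∏ i : Fin n, X i := by
  classical
  simp only [hcPoly, Matrix.hamiltonianCycleSum, Matrix.mvPolynomialX_apply, map_sum, map_prod, aeval_X]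
  have hσ : ∀ σ : Equiv.Perm (Fin n), ∏ i : Fin n, (X (σ i) : MvPolynomial (Fin n) ℂ) = ∏ i : Fin n, X i :=
    fun σ => Equiv.prod_comp σ fun i => (X i : MvPolynomial (Fin n) ℂ)
  simp only [hσ, Finset.sum_const, nsmul_eq_mul, map_natCast]

/-- **The Hamiltonian cycle polynomial has no polynomial-dimension homomorphism expansion either** (so R1's class
excludes `HC_n` as well as `per_n`). [cite: DwivediPagoSeppelt2026, Outlook (p. 12)] -/
theorem hcPoly_not_polyDimension_homExpansion :
    ¬ ∃ (c : ℕ) (m : ℕ → ℕ) (a b : (n : ℕ) → Fin (m n) → ℕ)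
        (E : (n : ℕ) → (i : Fin (m n)) → Multiset (Fin (a n i) × Fin (b n i))) (α : (n : ℕ) → Fin (m n) → ℂ),
        (∀ n, m n ≤ (n + 2) ^ c) ∧
          ∀ n, hcPoly (Fin n) ℂ = ∑ i : Fin (m n), MvPolynomial.C (α n i) * homPoly (E n i) n ℂ := by
  classical
  refine not_polyDimension_homExpansion_of_rowShadow _ ⟨2, fun n hn => ⟨_, ?_, rowShadow_hcPoly n⟩⟩
  -- there is an `n`-cycle for `n ≥ 2`: `finRotate n`
  obtain ⟨k, rfl⟩ := Nat.exists_eq_add_of_le' hn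
  have hmem : finRotate (k + 2) ∈ Finset.univ.filter fun π : Equiv.Perm (Fin (k + 2)) =>
      π.cycleType = {Fintype.card (Fin (k + 2))} := by
    rw [Finset.mem_filter, Fintype.card_fin]
    exact ⟨Finset.mem_univ _, cycleType_finRotate⟩
  have hpos : 0 < (Finset.univ.filter fun π : Equiv.Perm (Fin (k + 2)) =>
      π.cycleType = {Fintype.card (Fin (k + 2))}).card := Finset.card_pos.2 ⟨_, hmem⟩
  exact_mod_cast hpos.ne'

end PerHomExpansion

end Summit.ValiantsHypothesis.ValiantsHypothesis.Theorems

end
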